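import Summits.MatrixMultiplication.OmegaCensus.STPPVosperTilingWordsEnum

/-!
# ω-census (abelian STPP census): a PRUNED block enumerator for the exact-cover checker with words, and its soundness (kernel)

HONEST FRAMING (pub-omega census; verbatim): lottery ticket; floor = certified bounds/negative ranges.
Census STRUCTURE (seat pub-omega-stpp-1 gen 32, 2026-08-28), family (b2).  `blockDiffsW` (`STPPVosperTilingWords.lean`) enumerates the `c`-subsets `C` of
the Y-points first and only then computes the `B′`- and `A`-candidates of each; for blocks with `c = 4, 5` over `16` Y-points this dominates the kernel time
(K1 `{(1,1,2),(2,2,3),(3,4,2)²} @ ℤ₆₁`: `1 820` subsets per configuration).  `blockDiffsWP` chooses the points of `C` ONE BY ONE along `YL` and filters the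
two candidate lists at every step (`keepPts`: keep `x` iff `(y − x) mod p` is a Y-point, resp. a Z-point, for the new point `y`), cutting a branch as soon as
fewer than `b − 1` resp. `a` candidates remain (`extC`); the surviving `(C, candB′, candA)` are expanded exactly as before (`blockTriple`: duplicate-free
difference lists + within-block words), with the `C − B` duplicate-freeness tested once per `B′`.  Same OUTPUT CONTRACT as `blockDiffsW` — it is a sound
block enumerator, `blockEnumSound_blockDiffsWP : BlockEnumSound p (blockDiffsWP p)` — so `existsCoverW_complete_enum` / the extraction lemmas apply
verbatim.  Python mirror (identical candidate sets to `blockDiffsW` on K5; ≈ 10× fewer elementary steps): HOME `pub-omega-stpp-1-g32/code/coverwp_mirror.py`.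
UNCONDITIONAL.  Nothing here is progress on `ω`.

References: H. Cohn, R. Kleinberg, B. Szegedy, C. Umans, FOCS 2005 (arXiv:math/0511460), Def. 5.1.
-/

open Finset
open scoped Pointwise

namespace Summit.MatrixMultiplication.OmegaCensus.CubeNB

open Literature.Computability.AlgebraicComplexity
open Literature.Combinatorics.Additive
open Summit.MatrixMultiplication.OmegaCensus.STPPKneser

/-! ## §1 The pruned enumerator -/

section Checker

/-- One pruning step: keep the candidates `x` with `(y − x) mod p` among the points `L`. [folklore] -/
def keepPts (p : ℕ) (L : List ℕ) (y : ℕ) (cands : List ℕ) : List ℕ := cands.filter fun x => decide ((y + p - x) % p ∈ L)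

/-- All the pruning steps of a list of chosen points, in order. [folklore] -/
def keepAll (p : ℕ) (L : List ℕ) (cs cands : List ℕ) : List ℕ := cs.foldl (fun acc y => keepPts p L y acc) cands

/-- **Pruned choice of `C`.**  `extC p YL ZL a b1 rest k C cB cA`: all ways to extend the chosen points `C` by `k` more points of `rest` (in order), carrying the
`B′`-candidates `cB` (filtered against `YL`) and the `A`-candidates `cA` (filtered against `ZL`); a state with fewer than `b1` resp. `a` candidates is
discarded.  Returns the final `(C, cB, cA)`. [folklore] -/
def extC (p : ℕ) (YL ZL : List ℕ) (a b1 : ℕ) : List ℕ → ℕ → List ℕ → List ℕ → List ℕ → List (List ℕ × List ℕ × List ℕ)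
  | [], k, C, cB, cA => if k = 0 ∧ b1 ≤ cB.length ∧ a ≤ cA.length then [(C, cB, cA)] else []
  | y :: rest, k, C, cB, cA =>
    if b1 ≤ cB.length ∧ a ≤ cA.length then
      match k with
      | 0 => [(C, cB, cA)]
      | k' + 1 => extC p YL ZL a b1 rest k' (C ++ [y]) (keepPts p YL y cB) (keepPts p ZL y cA) ++ extC p YL ZL a b1 rest (k' + 1) C cB cA
    else []

/-- Unary pre-test of an `A`-candidate `x` once `C` and `B` are fixed: the within-block word `(c − b₁) − (x − b₂) ∉ ZL` (`b₁ ≠ b₂`).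
[cite: CohnKleinbergSzegedyUmans2005, Def. 5.1] -/
def aOK (p : ℕ) (ZL C B : List ℕ) (x : ℕ) : Bool :=
  B.all fun b₁ => B.all fun b₂ => decide (b₁ = b₂) || C.all fun c => !decide (((c + p - b₁) % p + p - (x + p - b₂) % p) % p ∈ ZL)

/-- **Pruned block enumerator.**  Candidate value triples `(C − B, C − A, A − B)` of ONE block of sizes `(a, b, c)` — same output contract as
`blockDiffsW`, computed through `extC`; `C − B` duplicate-freeness is tested once per `B′` and the `A`-candidates are pre-filtered by `aOK`. [folklore] -/
def blockDiffsWP (p : ℕ) (YL ZL : List ℕ) (a b c : ℕ) : List (List ℕ × List ℕ × List ℕ) :=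
  (extC p YL ZL a (b - 1) YL c [] ((List.range p).filter fun x => x != 0) (List.range p)).flatMap fun T =>
    (T.2.1.sublistsLen (b - 1)).flatMap fun B' =>
      if (diffList p T.1 (0 :: B')).Nodup then
        ((T.2.2.filter (aOK p ZL T.1 (0 :: B'))).sublistsLen a).filterMap fun A => blockTriple p YL ZL T.1 (0 :: B') A
      else []

end Checker

/-! ## §2 Soundness -/

section Sound

/-- Membership in `keepAll`. [folklore] -/
theorem mem_keepAll {p : ℕ} {L : List ℕ} {cs cands : List ℕ} {x : ℕ} :
    x ∈ keepAll p L cs cands ↔ x ∈ cands ∧ ∀ y ∈ cs, (y + p - x) % p ∈ L := by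
  induction cs generalizing cands with
  | nil => simp [keepAll]
  | cons y rest ih =>
    rw [keepAll, List.foldl_cons, ← keepAll, ih, keepPts, List.mem_filter, decide_eq_true_eq]
    constructor
    · rintro ⟨⟨h1, h2⟩, h3⟩
      exact ⟨h1, fun z hz => by
        rcases List.mem_cons.1 hz with rfl | hz
        · exact h2
        · exact h3 z hz⟩
    · rintro ⟨h1, h2⟩
      exact ⟨⟨h1, h2 y (by simp)⟩, fun z hz => h2 z (by simp [hz])⟩

/-- `keepAll` of a duplicate-free list is duplicate-free. [folklore] -/
theorem nodup_keepAll {p : ℕ} {L : List ℕ} {cs cands : List ℕ} (h : cands.Nodup) : (keepAll p L cs cands).Nodup := by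
  induction cs generalizing cands with
  | nil => simpa [keepAll] using h
  | cons y rest ih =>
    rw [keepAll, List.foldl_cons, ← keepAll]
    exact ih (h.filter _)

/-- A finset contained in a list has at most as many elements as the list. [folklore] -/
theorem card_le_length_of_subset {S : Finset ℕ} {l : List ℕ} (h : ∀ x ∈ S, x ∈ l) : #S ≤ l.length := by
  calc #S ≤ #l.toFinset := Finset.card_le_card fun x hx => List.mem_toFinset.2 (h x hx)
    _ ≤ l.length := List.toFinset_card_le l

/-- **`extC` reaches the real `C`.**  If the elements of `SB` survive every pruning step against `YL` along the points of `Cv` and those of `SA` every step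
against `ZL`, then from any state whose candidate lists are duplicate-free and contain `SB` resp. `SA` (`#SB = b1`, `#SA = a`), `extC` applied to `rest` with
`k = #(points of Cv in rest)` returns, among others, the state reached by choosing exactly the points of `Cv`. [folklore] -/
theorem mem_extC {p : ℕ} {YL ZL : List ℕ} {a b1 : ℕ} (Cv SB SA : Finset ℕ) (hSB : #SB = b1) (hSA : #SA = a)
    (hY : ∀ c ∈ Cv, ∀ x ∈ SB, (c + p - x) % p ∈ YL) (hZ : ∀ c ∈ Cv, ∀ x ∈ SA, (c + p - x) % p ∈ ZL) :
    ∀ (rest C cB cA : List ℕ), cB.Nodup → cA.Nodup → (∀ x ∈ SB, x ∈ cB) → (∀ x ∈ SA, x ∈ cA) →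
      (C ++ rest.filter (fun y => decide (y ∈ Cv)), keepAll p YL (rest.filter fun y => decide (y ∈ Cv)) cB,
        keepAll p ZL (rest.filter fun y => decide (y ∈ Cv)) cA) ∈
        extC p YL ZL a b1 rest (rest.filter fun y => decide (y ∈ Cv)).length C cB cA := by
  intro rest
  induction rest with
  | nil =>
    intro C cB cA _ _ hsB hsA
    have hlB : b1 ≤ cB.length := hSB ▸ card_le_length_of_subset hsB
    have hlA : a ≤ cA.length := hSA ▸ card_le_length_of_subset hsA
    simp [extC, keepAll, hlB, hlA]
  | cons y rest ih =>
    intro C cB cA hnB hnA hsB hsA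
    have hlB : b1 ≤ cB.length := hSB ▸ card_le_length_of_subset hsB
    have hlA : a ≤ cA.length := hSA ▸ card_le_length_of_subset hsA
    by_cases hy : y ∈ Cv
    · have hf : (y :: rest).filter (fun y => decide (y ∈ Cv)) = y :: rest.filter (fun y => decide (y ∈ Cv)) := by simp [hy]
      rw [hf, List.length_cons]
      simp only [extC, hlB, hlA, and_self, ↓reduceIte, List.mem_append]
      left
      have hsB' : ∀ x ∈ SB, x ∈ keepPts p YL y cB := fun x hx => by
        rw [keepPts, List.mem_filter, decide_eq_true_eq]; exact ⟨hsB x hx, hY y hy x hx⟩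
      have hsA' : ∀ x ∈ SA, x ∈ keepPts p ZL y cA := fun x hx => by
        rw [keepPts, List.mem_filter, decide_eq_true_eq]; exact ⟨hsA x hx, hZ y hy x hx⟩
      have h := ih (C ++ [y]) (keepPts p YL y cB) (keepPts p ZL y cA) (hnB.filter _) (hnA.filter _) hsB' hsA'
      rw [List.append_assoc, List.singleton_append] at h
      exact h
    · have hf : (y :: rest).filter (fun y => decide (y ∈ Cv)) = rest.filter (fun y => decide (y ∈ Cv)) := by simp [hy]
      rw [hf]
      rcases hk : (rest.filter fun y => decide (y ∈ Cv)).length with _ | k'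
      · have hnil : rest.filter (fun y => decide (y ∈ Cv)) = [] := List.length_eq_zero_iff.1 hk
        rw [hnil]
        simp [extC, hlB, hlA, keepAll]
      · simp only [extC, hlB, hlA, and_self, ↓reduceIte, List.mem_append]
        right
        have h := ih C cB cA hnB hnA hsB hsA
        rwa [hk] at h

/-- `aOK` holds for a candidate satisfying the unary within-block word. [folklore] -/
theorem aOK_of_forall {p : ℕ} {ZL C B : List ℕ} {x : ℕ}
    (h : ∀ b₁ ∈ B, ∀ b₂ ∈ B, b₁ ≠ b₂ → ∀ c ∈ C, ((c + p - b₁) % p + p - (x + p - b₂) % p) % p ∉ ZL) :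
    aOK p ZL C B x = true := by
  rw [aOK]
  simp only [List.all_eq_true, Bool.or_eq_true, decide_eq_true_eq, Bool.not_eq_true', decide_eq_false_iff_not]
  intro b₁ hb₁ b₂ hb₂
  by_cases hb : b₁ = b₂
  · exact Or.inl hb
  · exact Or.inr fun c hc => h b₁ hb₁ b₂ hb₂ hb c hc

/-- Membership in `blockDiffsWP` (the witnesses spelled out). [folklore] -/
theorem mem_blockDiffsWP {p : ℕ} {YL ZL : List ℕ} {a b c : ℕ} {C cB cA B' A : List ℕ}
    (hT : (C, cB, cA) ∈ extC p YL ZL a (b - 1) YL c [] ((List.range p).filter fun x => x != 0) (List.range p))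
    (hB : B' ∈ cB.sublistsLen (b - 1)) (hA : A ∈ (cA.filter (aOK p ZL C (0 :: B'))).sublistsLen a)
    (h1 : (diffList p C (0 :: B')).Nodup) (h2 : (diffList p C A).Nodup) (h3 : (diffList p A (0 :: B')).Nodup)
    (hw : wordsIn p YL ZL C (0 :: B') A = true) :
    (diffList p C (0 :: B'), diffList p C A, diffList p A (0 :: B')) ∈ blockDiffsWP p YL ZL a b c := by
  rw [blockDiffsWP, List.mem_flatMap]
  refine ⟨(C, cB, cA), hT, ?_⟩
  rw [List.mem_flatMap]
  refine ⟨B', hB, ?_⟩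
  simp only [h1, if_true]
  rw [List.mem_filterMap]
  refine ⟨A, hA, ?_⟩
  simp [blockTriple, h1, h2, h3, hw]

/-- **`blockDiffsWP` is a sound block enumerator.** [folklore] -/
theorem blockEnumSound_blockDiffsWP (p : ℕ) : BlockEnumSound p (blockDiffsWP p) := by
  intro YL ZL hYL a b c Av Bv Cv hszA hszB hszC hAp hBp hCp hB0 hY hZ hinjY hinjZ hinjX hw1 hw2 hw3
  -- the list realising C, in the order of YL
  have hCsub : ∀ x ∈ Cv, x ∈ YL := by
    intro x hx
    have h := hY x hx 0 hB0
    rwa [Nat.sub_zero, Nat.add_mod_right, Nat.mod_eq_of_lt (hCp x hx)] at h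
  set Cl := YL.filter (fun x => decide (x ∈ Cv)) with hCl
  have hClmem : ∀ x, x ∈ Cl ↔ x ∈ Cv := by
    intro x; rw [hCl, List.mem_filter, decide_eq_true_eq]; exact ⟨fun h => h.2, fun h => ⟨hCsub x h, h⟩⟩
  have hClnd : Cl.Nodup := hYL.filter _
  have hCllen : Cl.length = c := by rw [hCl, length_filter_mem_of_subset hYL hCsub, hszC]
  -- the pruned search reaches (Cl, cB*, cA*)
  set cB₀ := (List.range p).filter (fun x => x != 0) with hcB₀
  set cA₀ := List.range p with hcA₀
  have hcB₀nd : cB₀.Nodup := (List.nodup_range).filter _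
  have hcA₀nd : cA₀.Nodup := List.nodup_range
  have hsB₀ : ∀ x ∈ Bv.erase 0, x ∈ cB₀ := by
    intro x hx
    rw [Finset.mem_erase] at hx
    rw [hcB₀, List.mem_filter, List.mem_range]
    exact ⟨hBp x hx.2, by simpa using hx.1⟩
  have hsA₀ : ∀ x ∈ Av, x ∈ cA₀ := fun x hx => List.mem_range.2 (hAp x hx)
  have hYe : ∀ c' ∈ Cv, ∀ x ∈ Bv.erase 0, (c' + p - x) % p ∈ YL := fun c' hc' x hx => hY c' hc' x (Finset.mem_of_mem_erase hx)
  have hext := mem_extC (YL := YL) (ZL := ZL) Cv (Bv.erase 0) Av (by rw [Finset.card_erase_of_mem hB0, hszB]) hszA hYe hZ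
    YL [] cB₀ cA₀ hcB₀nd hcA₀nd hsB₀ hsA₀
  rw [List.nil_append, ← hCl, hCllen] at hext
  set cBf := keepAll p YL Cl cB₀ with hcBf
  set cAf := keepAll p ZL Cl cA₀ with hcAf
  -- the lists realising B′ and A
  set Bl := cBf.filter (fun x => decide (x ∈ Bv.erase 0)) with hBl
  have hBsub : ∀ x ∈ Bv.erase 0, x ∈ cBf := fun x hx =>
    mem_keepAll.2 ⟨hsB₀ x hx, fun y hy => hYe y ((hClmem y).1 hy) x hx⟩
  have hAsub : ∀ x ∈ Av, x ∈ cAf := fun x hx =>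
    mem_keepAll.2 ⟨hsA₀ x hx, fun y hy => hZ y ((hClmem y).1 hy) x hx⟩
  have hcBfnd : cBf.Nodup := nodup_keepAll hcB₀nd
  have hcAfnd : cAf.Nodup := nodup_keepAll hcA₀nd
  have hBlmem : ∀ x, x ∈ Bl ↔ x ∈ Bv.erase 0 := by
    intro x; rw [hBl, List.mem_filter, decide_eq_true_eq]; exact ⟨fun h => h.2, fun h => ⟨hBsub x h, h⟩⟩
  have hBlnd : Bl.Nodup := hcBfnd.filter _
  have hBllen : Bl.length = b - 1 := by
    rw [hBl, length_filter_mem_of_subset hcBfnd hBsub, Finset.card_erase_of_mem hB0, hszB]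
  have hB0l : ∀ x, x ∈ (0 :: Bl) ↔ x ∈ Bv := by
    intro x; rw [List.mem_cons, hBlmem, Finset.mem_erase]
    constructor
    · rintro (rfl | ⟨-, h⟩); exacts [hB0, h]
    · intro h; by_cases h0 : x = 0; exacts [Or.inl h0, Or.inr ⟨h0, h⟩]
  have hB0nd : (0 :: Bl).Nodup := by
    rw [List.nodup_cons]; refine ⟨fun h => ?_, hBlnd⟩
    have := (hBlmem 0).1 h; simp at this
  -- the A-candidates passing the unary pre-test
  set cAg := cAf.filter (aOK p ZL Cl (0 :: Bl)) with hcAg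
  have hAsubg : ∀ x ∈ Av, x ∈ cAg := fun x hx => by
    rw [hcAg, List.mem_filter]
    exact ⟨hAsub x hx, aOK_of_forall fun b₁ hb₁ b₂ hb₂ hne c' hc' =>
      hw2 b₁ ((hB0l _).1 hb₁) b₂ ((hB0l _).1 hb₂) hne c' ((hClmem _).1 hc') x hx⟩
  have hcAgnd : cAg.Nodup := hcAfnd.filter _
  set Al := cAg.filter (fun x => decide (x ∈ Av)) with hAl
  have hAlmem : ∀ x, x ∈ Al ↔ x ∈ Av := by
    intro x; rw [hAl, List.mem_filter, decide_eq_true_eq]; exact ⟨fun h => h.2, fun h => ⟨hAsubg x h, h⟩⟩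
  have hAlnd : Al.Nodup := hcAgnd.filter _
  have hAllen : Al.length = a := by rw [hAl, length_filter_mem_of_subset hcAgnd hAsubg, hszA]
  -- the three difference lists are duplicate-free
  have hn1 : (diffList p Cl (0 :: Bl)).Nodup := nodup_diffList hClnd hB0nd fun c₁ hc₁ c₂ hc₂ x₁ hx₁ x₂ hx₂ h =>
    hinjY c₁ ((hClmem _).1 hc₁) c₂ ((hClmem _).1 hc₂) x₁ ((hB0l _).1 hx₁) x₂ ((hB0l _).1 hx₂) h
  have hn2 : (diffList p Cl Al).Nodup := nodup_diffList hClnd hAlnd fun c₁ hc₁ c₂ hc₂ x₁ hx₁ x₂ hx₂ h =>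
    hinjZ c₁ ((hClmem _).1 hc₁) c₂ ((hClmem _).1 hc₂) x₁ ((hAlmem _).1 hx₁) x₂ ((hAlmem _).1 hx₂) h
  have hn3 : (diffList p Al (0 :: Bl)).Nodup := nodup_diffList hAlnd hB0nd fun c₁ hc₁ c₂ hc₂ x₁ hx₁ x₂ hx₂ h =>
    hinjX c₁ ((hAlmem _).1 hc₁) c₂ ((hAlmem _).1 hc₂) x₁ ((hB0l _).1 hx₁) x₂ ((hB0l _).1 hx₂) h
  -- the within-block words
  have hw : wordsIn p YL ZL Cl (0 :: Bl) Al = true := by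
    refine wordsIn_of_forall (fun a₁ ha₁ a₂ ha₂ hne y hy c' hc' => ?_) (fun b₁ hb₁ b₂ hb₂ hne c' hc' x hx => ?_)
      (fun c₁ hc₁ c₂ hc₂ hne y hy x hx hmem => ?_)
    · exact hw1 a₁ ((hAlmem _).1 ha₁) a₂ ((hAlmem _).1 ha₂) hne y ((hB0l _).1 hy) c' ((hClmem _).1 hc')
    · exact hw2 b₁ ((hB0l _).1 hb₁) b₂ ((hB0l _).1 hb₂) hne c' ((hClmem _).1 hc') x ((hAlmem _).1 hx)
    · obtain ⟨x', hx', y', hy', h⟩ := mem_diffList.1 hmem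
      exact hw3 c₁ ((hClmem _).1 hc₁) c₂ ((hClmem _).1 hc₂) hne y ((hB0l _).1 hy) x ((hAlmem _).1 hx) x' ((hAlmem _).1 hx')
        y' ((hB0l _).1 hy') h.symm
  exact ⟨Al, 0 :: Bl, Cl, hAlmem, hB0l, hClmem, mem_blockDiffsWP hext (List.mem_sublistsLen.2 ⟨List.filter_sublist, hBllen⟩)
    (List.mem_sublistsLen.2 ⟨List.filter_sublist, hAllen⟩) hn1 hn2 hn3 hw⟩

end Sound

end Summit.MatrixMultiplication.OmegaCensus.CubeNB
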